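import Literature.Probability.Percolation.ArmSeparationOutSlots
import Literature.Probability.Percolation.ArmSeparationSlotSep
import HarnessLib

/-!
# Arithmetic of the outer routing: valid rungs, entry pieces, exit runs, windows

Topic: Probability / Percolation; family `crit-perc`. A brick of the discharge of
`Literature.Probability.Percolation.Nolin2008_twoArm_separation` (Nolin 2008, Thm. 11
[arXiv 0711.4948: Thm. 10]; `ArmSeparation.lean`), landing step of the external extremities
(Nolin 2008, Prop. 12 [arXiv Prop. 11], §4.4 p. 12). Index arithmetic behind the routing functions
of `ArmSeparationOutSlots.lean` (the outward twin of `ArmSeparationSlotArith.lean` and of the window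
facts of `ArmSeparationSlotSep.lean`):

* `OParams.Valid` — the standing size conditions of an outer rung, with `Valid.facts` / `Valid.ifacts`;
* `ospokeMeets_pieceTube` — the outer spoke of a tip of the frame `i` with lateral position `ξ`
  meets the piece of lateral index `⌊(ξ + r)/s⌋` of the side `i` of a thin ring of radius `r`
  beyond the beacon (the six junction conditions `SpokeMeets` checked numerically);
* `Slot.OInRange`, `Slot.OAdmissible`, `Slot.OSepOK` and their derivation from
  `oblackArm σ ∩ owhiteArm σ ≠ ∅` (`Slot.oadmissible_of_mem`, `Slot.osepOK_of_mem`, by the row gap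
  `row_gap_of_lt` of two fenced outer tips of different colours on a common side);
* `Slot.owindowB_facts`, `Slot.owindowW_facts` — the windows lie inside the blocks of their sides;
  `Slot.ogEo_mem_arc`, `Slot.ogEc_mem_arc` — the entry pieces lie on the arcs; `Slot.orunB_mem_arc`,
  `Slot.orunW_mem_arc` — the exit runs lie on the arcs and span the rows of the approach tubes.

## References

* P. Nolin, *Near-critical percolation in two dimensions*, Electron. J. Probab. 13 (2008), §4.3
  Prop. 12, §4.4 [arXiv 0711.4948: Prop. 11, Thm. 10, p. 12]. [Nolin2008]
-/

noncomputable section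

open Set

namespace Literature.Probability.Percolation

open LatticeModels Tube

/-! ### Standing size conditions -/

namespace OParams

/-- **Standing size conditions of an outer rung**: a large smallest scale `k₀ ≥ 64`, at least one
scale (`1 ≤ K`, so that `μ ≥ 32 k₀`), arms from inside `Λ_M` (`n ≤ M`), the depth unit small
(`64 μ ≤ M`), the tip margin between `8μ` and `M/4`. [cite: Nolin2008, §4.4 (arXiv 0711.4948: Thm. 10, external extremities)] -/
structure Valid (P : OParams) : Prop where
  /-- smallest scale -/
  hk₀ : 64 ≤ P.k₀
  /-- at least one scale -/
  hK : 1 ≤ P.K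
  /-- arms come from `Λ_M` -/
  hn : P.n ≤ P.M
  /-- depth unit -/
  hμM : 64 * P.μ ≤ P.M
  /-- tip margin, below -/
  hR₀ : 8 * P.μ ≤ P.R₀
  /-- tip margin, above -/
  hR₀M : 4 * P.R₀ ≤ P.M

variable {P : OParams}

/-- Every fence scale is at most `μ / 32`. [folklore] -/
theorem scale_le (P : OParams) {j : ℕ} (hj : j < P.K) : 32 * trapScale P.k₀ j ≤ P.μ := by
  unfold OParams.μ
  calc 32 * trapScale P.k₀ j = trapScale P.k₀ (j + 1) := (trapScale_succ _ _).symm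
    _ ≤ trapScale P.k₀ P.K := trapScale_mono _ hj

/-- **The numeric facts of a valid outer rung.** [folklore] -/
theorem Valid.facts (hV : P.Valid) :
    P.s = P.k₀ ∧ P.w = P.k₀ / 4 ∧ P.e = P.k₀ / 4 ∧ P.ε = P.k₀ / 16 ∧ 64 ≤ P.k₀ ∧ 32 * P.k₀ ≤ P.μ ∧
      2 * P.M + P.μ < P.rB ∧ P.rB ≤ 2 * P.M + P.μ + P.s ∧ 2 * P.M + 3 * P.μ < P.rW ∧ P.rW ≤ 2 * P.M + 3 * P.μ + P.s ∧
      P.nB * P.s = P.rB ∧ P.nW * P.s = P.rW ∧ P.N' = 4 * P.M ∧ P.rB + P.WB = P.N' + P.N' / 16 + 2 * P.e ∧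
      P.rW + P.WW = P.N' + P.N' / 16 + 2 * P.e ∧ P.n ≤ P.M ∧ 64 * P.μ ≤ P.M ∧ 8 * P.μ ≤ P.R₀ ∧ 4 * P.R₀ ≤ P.M ∧
      P.LB = P.μ + 2 * P.s + 4 * P.e ∧ P.LW = 3 * P.μ + 2 * P.s + 4 * P.e := by
  have hs : P.s = P.k₀ := rfl
  have hk : 1 ≤ P.k₀ := le_trans (by norm_num) hV.hk₀
  have hμ : 32 * P.k₀ ≤ P.μ := by
    have h := P.scale_le (j := 0) (by have := hV.hK; omega)
    unfold trapScale at h; simpa using h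
  have hrB1 : 2 * P.M + P.μ < P.rB := by
    unfold OParams.rB; rw [hs]; exact Nat.lt_div_mul_add hk |>.trans_eq (by ring)
  have hrB2 : P.rB ≤ 2 * P.M + P.μ + P.s := by
    unfold OParams.rB; rw [hs]; have := Nat.div_mul_le_self (2 * P.M + P.μ) P.k₀; rw [Nat.mul_comm]; omega
  have hrW1 : 2 * P.M + 3 * P.μ < P.rW := by
    unfold OParams.rW; rw [hs]; exact Nat.lt_div_mul_add hk |>.trans_eq (by ring)
  have hrW2 : P.rW ≤ 2 * P.M + 3 * P.μ + P.s := by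
    unfold OParams.rW; rw [hs]; have := Nat.div_mul_le_self (2 * P.M + 3 * P.μ) P.k₀; rw [Nat.mul_comm]; omega
  have hnB : P.nB * P.s = P.rB := by
    unfold OParams.nB OParams.rB; rw [hs, show P.k₀ * ((2 * P.M + P.μ) / P.k₀) + P.k₀ = P.k₀ * ((2 * P.M + P.μ) / P.k₀ + 1) by ring,
      Nat.mul_div_cancel_left _ hk, mul_comm]
  have hnW : P.nW * P.s = P.rW := by
    unfold OParams.nW OParams.rW; rw [hs, show P.k₀ * ((2 * P.M + 3 * P.μ) / P.k₀) + P.k₀ = P.k₀ * ((2 * P.M + 3 * P.μ) / P.k₀ + 1) by ring,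
      Nat.mul_div_cancel_left _ hk, mul_comm]
  have hN : P.N' = 4 * P.M := rfl
  have hμM := hV.hμM
  have he : P.e = P.k₀ / 4 := rfl
  refine ⟨rfl, rfl, rfl, rfl, hV.hk₀, hμ, hrB1, hrB2, hrW1, hrW2, hnB, hnW, hN, ?_, ?_, hV.hn, hμM, hV.hR₀, hV.hR₀M, rfl, rfl⟩
  · unfold OParams.WB; omega
  · unfold OParams.WW; omega

/-- **The integer facts** of a valid outer rung — subtraction-free and cast to `ℤ`. [folklore] -/
theorem Valid.ifacts (hV : P.Valid) :
    (P.s : ℤ) = P.k₀ ∧ 64 ≤ (P.k₀ : ℤ) ∧ 32 * (P.k₀ : ℤ) ≤ P.μ ∧ 4 * (P.w : ℤ) ≤ P.k₀ ∧ (P.k₀ : ℤ) ≤ 4 * P.w + 3 ∧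
      4 * (P.e : ℤ) ≤ P.k₀ ∧ (P.k₀ : ℤ) ≤ 4 * P.e + 3 ∧ 16 * (P.ε : ℤ) ≤ P.k₀ ∧ (P.k₀ : ℤ) ≤ 16 * P.ε + 15 ∧
      2 * (P.M : ℤ) + P.μ < P.rB ∧ (P.rB : ℤ) ≤ 2 * P.M + P.μ + P.s ∧ 2 * (P.M : ℤ) + 3 * P.μ < P.rW ∧
      (P.rW : ℤ) ≤ 2 * P.M + 3 * P.μ + P.s ∧ ((P.nB : ℕ) : ℤ) * P.s = P.rB ∧ ((P.nW : ℕ) : ℤ) * P.s = P.rW ∧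
      (P.N' : ℤ) = 4 * P.M ∧ (P.rB : ℤ) - 2 * P.e + P.WB = P.N' + (P.N' / 16 : ℕ) ∧
      (P.rW : ℤ) - 2 * P.e + P.WW = P.N' + (P.N' / 16 : ℕ) ∧ (P.n : ℤ) ≤ P.M ∧ 64 * (P.μ : ℤ) ≤ P.M ∧
      8 * (P.μ : ℤ) ≤ P.R₀ ∧ 4 * (P.R₀ : ℤ) ≤ P.M ∧ (P.LB : ℤ) = P.μ + 2 * P.s + 4 * P.e ∧ (P.LW : ℤ) = 3 * P.μ + 2 * P.s + 4 * P.e := by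
  obtain ⟨hs, hw, he, hε, hk₀, hμ, hrB1, hrB2, hrW1, hrW2, hnB, hnW, hN, hWB, hWW, hn, hμM, hR₀, hR₀M, hLB, hLW⟩ := hV.facts
  refine ⟨by rw [hs], by exact_mod_cast hk₀, by exact_mod_cast hμ, by rw [hw]; omega, by rw [hw]; omega, by rw [he]; omega,
    by rw [he]; omega, by rw [hε]; omega, by rw [hε]; omega, by exact_mod_cast hrB1, by exact_mod_cast hrB2, by exact_mod_cast hrW1,
    by exact_mod_cast hrW2, by exact_mod_cast hnB, by exact_mod_cast hnW, by rw [hN]; push_cast; ring, ?_, ?_, by exact_mod_cast hn,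
    by exact_mod_cast hμM, by exact_mod_cast hR₀, by exact_mod_cast hR₀M, by rw [hLB]; push_cast; ring, by rw [hLW]; push_cast; ring⟩
  · have h : (P.rB : ℤ) + P.WB = P.N' + (P.N' / 16 : ℕ) + 2 * P.e := by exact_mod_cast hWB
    linarith
  · have h : (P.rW : ℤ) + P.WW = P.N' + (P.N' / 16 : ℕ) + 2 * P.e := by exact_mod_cast hWW
    linarith

/-- `1 ≤ nB` for a valid rung. [folklore] -/
theorem Valid.one_le_nB (hV : P.Valid) : 1 ≤ P.nB := by
  obtain ⟨hs, -, -, -, hk₀, -, hrB1, -, -, -, hnB, -⟩ := hV.facts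
  refine Nat.pos_of_ne_zero fun h0 => ?_
  rw [h0, zero_mul] at hnB
  omega

/-- `1 ≤ nW` for a valid rung. [folklore] -/
theorem Valid.one_le_nW (hV : P.Valid) : 1 ≤ P.nW := by
  obtain ⟨hs, -, -, -, hk₀, -, -, -, hrW1, -, -, hnW, -⟩ := hV.facts
  refine Nat.pos_of_ne_zero fun h0 => ?_
  rw [h0, zero_mul] at hnW
  omega

end OParams

/-! ### The outer spoke meets its entry piece -/

section Meets

variable {M k : ℕ} {T₀ : ℤ} {w L ε r e s n ι : ℕ}

/-- Frame `0`: the outer spoke meets `V_ι`. [folklore] -/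
theorem ospokeMeets_zero (hι : -(r : ℤ) + ι * s ≤ T₀ + 2 * k + w ∧ T₀ + 2 * k + w < -(r : ℤ) + (ι + 1) * s) (hεe : ε ≤ e)
    (ha : (r : ℤ) + e + ε ≤ 2 * M + 2 * k - 1 + L) (hb : 2 * (M : ℤ) + 2 * k + s + e + ε ≤ r) :
    SpokeMeets 0 (ospokeTube M k T₀ w L ε) (vPiece r (-(r : ℤ)) e s ι) := by
  have hεe' : (ε : ℤ) ≤ e := by exact_mod_cast hεe
  refine ⟨rfl, ?_, ?_, ?_, ?_⟩ <;>
    simp only [ospokeTube, obcnCentre, site_mk_apply_zero, site_mk_apply_one, vPiece, Nat.cast_add, Nat.cast_mul, Nat.cast_ofNat] <;>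
    linarith [hι.1, hι.2]

/-- Frame `1`: the outer spoke meets the step `H_ι`. [folklore] -/
theorem ospokeMeets_one (hι : -(r : ℤ) + ι * s ≤ T₀ + 2 * k + w ∧ T₀ + 2 * k + w < -(r : ℤ) + (ι + 1) * s) (hεe : ε ≤ e)
    (ha : (r : ℤ) + e + ε ≤ 2 * M + 2 * k - 1 + L) (hb : 2 * (M : ℤ) + 2 * k + s + e + ε ≤ r) :
    SpokeMeets 1 (ospokeTube M k T₀ w L ε) (stairH r e s ι) := by
  have hεe' : (ε : ℤ) ≤ e := by exact_mod_cast hεe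
  refine ⟨rfl, ?_, ?_, ?_, ?_⟩ <;>
    simp only [ospokeTube, obcnCentre, site_mk_apply_zero, site_mk_apply_one, stairH, Nat.cast_add, Nat.cast_mul, Nat.cast_ofNat] <;>
    linarith [hι.1, hι.2]

/-- Frame `2`: the outer spoke meets the piece `H_{n-1-ι}` of the side `x₁ = r` (`n s = r`, `ι < n`). [folklore] -/
theorem ospokeMeets_two (hns : n * s = r) (hιn : ι < n)
    (hι : -(r : ℤ) + ι * s ≤ T₀ + 2 * k + w ∧ T₀ + 2 * k + w < -(r : ℤ) + (ι + 1) * s) (hεe : ε ≤ e)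
    (ha : (r : ℤ) + e + ε ≤ 2 * M + 2 * k - 1 + L) (hb : 2 * (M : ℤ) + 2 * k + s + e + ε ≤ r) :
    SpokeMeets 2 (ospokeTube M k T₀ w L ε) (hPiece 0 r e s (n - 1 - ι)) := by
  have hεe' : (ε : ℤ) ≤ e := by exact_mod_cast hεe
  have hns' : (n : ℤ) * s = r := by exact_mod_cast hns
  have hcast : ((n - 1 - ι : ℕ) : ℤ) = n - 1 - ι := by omega
  refine ⟨rfl, ?_, ?_, ?_, ?_⟩ <;>
    simp only [ospokeTube, obcnCentre, site_mk_apply_zero, site_mk_apply_one, hPiece, hcast, Nat.cast_add, Nat.cast_mul,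
      Nat.cast_ofNat] <;>
    linarith [hι.1, hι.2]

/-- Frame `3`: the outer spoke meets `-V_ι`. [folklore] -/
theorem ospokeMeets_three (hι : -(r : ℤ) + ι * s ≤ T₀ + 2 * k + w ∧ T₀ + 2 * k + w < -(r : ℤ) + (ι + 1) * s) (hεe : ε ≤ e)
    (ha : (r : ℤ) + e + ε ≤ 2 * M + 2 * k - 1 + L) (hb : 2 * (M : ℤ) + 2 * k + s + e + ε ≤ r) :
    SpokeMeets 3 (ospokeTube M k T₀ w L ε) (vPiece r (-(r : ℤ)) e s ι).neg := by
  have hεe' : (ε : ℤ) ≤ e := by exact_mod_cast hεe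
  refine ⟨rfl, ?_, ?_, ?_, ?_⟩ <;>
    simp only [ospokeTube, obcnCentre, site_mk_apply_zero, site_mk_apply_one, vPiece, neg_a, neg_b, neg_w, neg_h, Nat.cast_add,
      Nat.cast_mul, Nat.cast_ofNat] <;>
    linarith [hι.1, hι.2]

/-- Frame `4`: the outer spoke meets `-H_ι`. [folklore] -/
theorem ospokeMeets_four (hι : -(r : ℤ) + ι * s ≤ T₀ + 2 * k + w ∧ T₀ + 2 * k + w < -(r : ℤ) + (ι + 1) * s) (hεe : ε ≤ e)
    (ha : (r : ℤ) + e + ε ≤ 2 * M + 2 * k - 1 + L) (hb : 2 * (M : ℤ) + 2 * k + s + e + ε ≤ r) :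
    SpokeMeets 4 (ospokeTube M k T₀ w L ε) (stairH r e s ι).neg := by
  have hεe' : (ε : ℤ) ≤ e := by exact_mod_cast hεe
  refine ⟨rfl, ?_, ?_, ?_, ?_⟩ <;>
    simp only [ospokeTube, obcnCentre, site_mk_apply_zero, site_mk_apply_one, stairH, neg_a, neg_b, neg_w, neg_h, Nat.cast_add,
      Nat.cast_mul, Nat.cast_ofNat] <;>
    linarith [hι.1, hι.2]

/-- Frame `5`: the outer spoke meets `-H_{n-1-ι}` (`n s = r`, `ι < n`). [folklore] -/
theorem ospokeMeets_five (hns : n * s = r) (hιn : ι < n)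
    (hι : -(r : ℤ) + ι * s ≤ T₀ + 2 * k + w ∧ T₀ + 2 * k + w < -(r : ℤ) + (ι + 1) * s) (hεe : ε ≤ e)
    (ha : (r : ℤ) + e + ε ≤ 2 * M + 2 * k - 1 + L) (hb : 2 * (M : ℤ) + 2 * k + s + e + ε ≤ r) :
    SpokeMeets 5 (ospokeTube M k T₀ w L ε) (hPiece 0 r e s (n - 1 - ι)).neg := by
  have hεe' : (ε : ℤ) ≤ e := by exact_mod_cast hεe
  have hns' : (n : ℤ) * s = r := by exact_mod_cast hns
  have hcast : ((n - 1 - ι : ℕ) : ℤ) = n - 1 - ι := by omega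
  refine ⟨rfl, ?_, ?_, ?_, ?_⟩ <;>
    simp only [ospokeTube, obcnCentre, site_mk_apply_zero, site_mk_apply_one, hPiece, hcast, neg_a, neg_b, neg_w, neg_h, Nat.cast_add,
      Nat.cast_mul, Nat.cast_ofNat] <;>
    linarith [hι.1, hι.2]

/-- **The outer spoke of a tip of the frame `i` meets the piece of its side with the lateral index
of the spoke.** With `ξ = T₀ + 2k + w` the lateral position of the spoke, `ι` such that
`-r + ι s ≤ ξ < -r + (ι+1) s`, `ε ≤ e`, `r + e + ε ≤ 2M + 2k - 1 + L` (the spoke crosses the ring's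
band) and `2M + 2k + s + e + ε ≤ r` (the ring lies a chunk beyond the beacon), the six junction
conditions hold. [cite: Nolin2008, §4.3 Prop. 12 (proof) (arXiv 0711.4948: Prop. 11)] -/
theorem ospokeMeets_pieceTube {i : ℕ} (hi : i < 6) (hns : n * s = r) (hιn : ι < n)
    (hι : -(r : ℤ) + ι * s ≤ T₀ + 2 * k + w ∧ T₀ + 2 * k + w < -(r : ℤ) + (ι + 1) * s) (hεe : ε ≤ e)
    (ha : (r : ℤ) + e + ε ≤ 2 * M + 2 * k - 1 + L) (hb : 2 * (M : ℤ) + 2 * k + s + e + ε ≤ r) :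
    SpokeMeets i (ospokeTube M k T₀ w L ε) (pieceTube r e s n i ι) := by
  interval_cases i
  · exact ospokeMeets_zero hι hεe ha hb
  · exact ospokeMeets_one hι hεe ha hb
  · exact ospokeMeets_two hns hιn hι hεe ha hb
  · exact ospokeMeets_three hι hεe ha hb
  · exact ospokeMeets_four hι hεe ha hb
  · exact ospokeMeets_five hns hιn hι hεe ha hb

end Meets

/-! ### Slots in range, admissible, separated -/

namespace Slot

variable (P : OParams) (σ : Slot)

/-- The slot's indices are in range. [folklore] -/
structure OInRange : Prop where
  /-- side of the open tip -/
  hio : σ.io < 6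
  /-- scale index of the open tip -/
  hjo : σ.jo < P.K
  /-- side of the closed tip -/
  hic : σ.ic < 6
  /-- scale index of the closed tip -/
  hjc : σ.jc < P.K

/-- **Admissible slot**: both windows can hold a middle tip row `t` with `-2M + R₀ ≤ t ≤ -R₀`. [folklore] -/
def OAdmissible (P' : OParams) (σ' : Slot) : Prop :=
  σ'.oTo P' ≤ -(P'.R₀ : ℤ) ∧ -(2 * (P'.M : ℤ)) + P'.R₀ < σ'.oTo P' + P'.w ∧ σ'.oTc P' ≤ -(P'.R₀ : ℤ) ∧ -(2 * (P'.M : ℤ)) + P'.R₀ < σ'.oTc P' + P'.w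

/-- **Separated slot**: tips on a common side have windows as far apart as the row gap of two fenced
outer tips of different colours (`row_gap_of_lt`). [folklore] -/
def OSepOK (P' : OParams) (σ' : Slot) : Prop :=
  σ'.io ≠ σ'.ic ∨ σ'.oTo P' + 8 * σ'.oko P' < σ'.oTc P' + P'.w ∨ σ'.oTc P' + 8 * σ'.okc P' < σ'.oTo P' + P'.w

variable {P σ}

/-- A slot holding both arms is admissible. [folklore] -/
theorem oadmissible_of_mem {ω : SiteConfig (Site 2)} (hω : ω ∈ σ.oblackArm P ∩ σ.owhiteArm P) : σ.OAdmissible P := by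
  obtain ⟨⟨Fo, ho, -, h1, h2⟩, ⟨Fc, hc, -, h3, h4⟩⟩ := hω
  exact ⟨by omega, by omega, by omega, by omega⟩

/-- **A slot holding both arms is separated** (valid rung, `io < 6`): on a common side the tips are
fenced tips of complementary colours, so their rows differ by more than `8k` (`row_gap_of_lt`). [cite: Nolin2008, §4.4 (arXiv 0711.4948: Thm. 10, external extremities: fences of different colours)] -/
theorem osepOK_of_mem (hV : P.Valid) {ω : SiteConfig (Site 2)} (hω : ω ∈ σ.oblackArm P ∩ σ.owhiteArm P) : σ.OSepOK P := by
  unfold OSepOK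
  by_cases hii : σ.io ≠ σ.ic
  · exact Or.inl hii
  right
  push Not at hii
  obtain ⟨⟨Fo, -, hjo, h1, h2⟩, ⟨Fc, -, hjc, h3, h4⟩⟩ := hω
  obtain ⟨hs, -, -, -, hk₀, hμ, -, -, -, -, -, -, -, -, -, hn, hμM, -⟩ := hV.facts
  have hKM : ∀ j < P.K, 128 * (trapScale P.k₀ j : ℤ) < P.M := fun j hj => by
    have := P.scale_le hj; omega
  have hko : (Fo.k : ℤ) = σ.oko P := by show ((trapScale P.k₀ Fo.j : ℕ) : ℤ) = trapScale P.k₀ σ.jo; rw [hjo]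
  have hkc : (Fc.k : ℤ) = σ.okc P := by show ((trapScale P.k₀ Fc.j : ℕ) : ℤ) = trapScale P.k₀ σ.jc; rw [hjc]
  have hcol : ∀ v, v ∈ (frameConfig σ.ic ω)ᶜ → v ∉ frameConfig σ.io ω := fun v hv hv' => hv (by rw [← hii]; exact hv')
  have hcol' : ∀ v, v ∈ frameConfig σ.io ω → v ∉ (frameConfig σ.ic ω)ᶜ := fun v hv hv' => hv' (by rw [← hii]; exact hv)
  have hne : Fo.z 1 ≠ Fc.z 1 := fun h => by
    have heq : Fo.z = Fc.z := eq_of_mem_trapO Fo.z_mem Fc.z_mem h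
    have h1 : Fo.z ∈ frameConfig σ.ic ω := by rw [← hii]; exact Fo.z_mem_config
    rw [heq] at h1
    exact Fc.z_mem_config h1
  rcases lt_or_gt_of_ne hne with hlt | hlt
  · have := row_gap_of_lt hn (by omega) hKM hcol Fo Fc hlt
    left; omega
  · have := row_gap_of_lt hn (by omega) hKM hcol' Fc Fo hlt
    right; omega

/-! ### Windows -/

/-- **The window of ring `B`** lies inside the block of the side `ic`, inside the ring, and brackets
the lateral position of the white spoke. [folklore] -/
theorem owindowB_facts (hV : P.Valid) (hσ : σ.OInRange P) (hadm : σ.OAdmissible P) :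
    2 ≤ σ.oιc P ∧ σ.oιc P + 3 ≤ P.nB ∧ 1 ≤ P.nB ∧
      blockOff P.nB σ.ic ≤ σ.oloB P ∧ σ.ohiB P = σ.oloB P + 5 ∧ σ.ohiB P < blockEnd P.nB σ.ic ∧ σ.ohiB P < 12 * P.nB - 4 ∧
      -(P.rB : ℤ) + (σ.oιc P : ℕ) * P.s ≤ σ.oξc P ∧ σ.oξc P < -(P.rB : ℤ) + ((σ.oιc P : ℕ) + 1) * P.s := by
  obtain ⟨hs, hk₀, hμ, hw1, hw2, he1, he2, hε1, hε2, hrB1, hrB2, hrW1, hrW2, hnB, hnW, hN, hWB, hWW, hn, hμM, hR₀, hR₀M, hLB, hLW⟩ := hV.ifacts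
  have hkc1 : (P.k₀ : ℤ) ≤ σ.okc P := by exact_mod_cast le_trapScale P.k₀ σ.jc
  have hkc2 : 32 * (σ.okc P : ℤ) ≤ P.μ := by exact_mod_cast P.scale_le hσ.hjc
  obtain ⟨-, -, ha3, ha4⟩ := hadm
  have hξc : σ.oξc P = σ.oTc P + 2 * σ.okc P + P.w := rfl
  have hnB1 := hV.one_le_nB
  have hspec := latIdx_spec (r := P.rB) (s := P.s) (by omega) (show -(P.rB : ℤ) ≤ σ.oξc P by omega)
  have hι1 : 2 ≤ σ.oιc P := by
    unfold Slot.oιc latIdx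
    apply (Nat.le_div_iff_mul_le (by omega)).2
    have : 2 * (P.s : ℤ) ≤ σ.oξc P + P.rB := by omega
    omega
  have hι2 : σ.oιc P + 3 ≤ P.nB := by
    refine idx_le_of_mul_le (s := P.s) (c := 0) (by omega) ?_ (by omega)
    rw [Nat.cast_add, Nat.cast_ofNat, add_mul, hnB]
    have h1 : -(P.rB : ℤ) + (σ.oιc P : ℕ) * P.s ≤ σ.oξc P := hspec.1
    linarith
  obtain ⟨hhi, hhi'⟩ := window_pos_bounds (n := P.nB) hσ.hic hι1 hι2
  refine ⟨hι1, hι2, hnB1, ?_, rfl, hhi, ?_, hspec.1, hspec.2⟩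
  · unfold Slot.oloB; exact Nat.le_add_right _ _
  · unfold Slot.ohiB Slot.oloB; exact Nat.lt_of_lt_of_le hhi hhi'

/-- **The window of ring `W`** lies inside the block of the side `3`, inside the ring, and brackets
the rows of the approach tube of the open arm; the exit run of the closed arm spans the target rows. [folklore] -/
theorem owindowW_facts (hV : P.Valid) :
    1 ≤ P.nW ∧ σ.oloW P ≤ σ.ohiW P ∧ σ.ohiW P < 12 * P.nW - 4 ∧ blockOff P.nW 3 ≤ σ.oloW P ∧ σ.ohiW P < blockOff P.nW 4 ∧
      1 ≤ σ.oyLo P ∧ σ.oyHi P + 1 < P.nW ∧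
      -(P.rW : ℤ) + ((σ.oyLo P : ℕ) + 1) * P.s ≤ σ.otgo P ∧ σ.otgo P + (P.N' / 64 : ℕ) < -(P.rW : ℤ) + (σ.oyHi P : ℕ) * P.s ∧
      σ.otgo P < -(P.rW : ℤ) + ((σ.oyLo P : ℕ) + 1 + 1) * P.s ∧ -(P.rW : ℤ) + (σ.oyHi P : ℕ) * P.s ≤ σ.otgo P + (P.N' / 64 : ℕ) + P.s ∧
      σ.oxc P + P.d < P.nW ∧
      -(P.rW : ℤ) + (σ.oxc P : ℕ) * P.s - P.e ≤ σ.otgc P ∧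
      σ.otgc P + (P.N' / 64 : ℕ) ≤ -(P.rW : ℤ) + ((σ.oxc P : ℕ) + P.d) * P.s - P.e := by
  obtain ⟨hs, hk₀, hμ, hw1, hw2, he1, he2, hε1, hε2, hrB1, hrB2, hrW1, hrW2, hnB, hnW, hN, hWB, hWW, hn, hμM, hR₀, hR₀M, hLB, hLW⟩ := hV.ifacts
  have hnW1 := hV.one_le_nW
  have htgo := otgtRow_mem P.N' (σ.obo P)
  have htgc := otgtRow_mem P.N' (σ.obc P)
  rw [show otgtRow P.N' (σ.obo P) = σ.otgo P from rfl] at htgo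
  rw [show otgtRow P.N' (σ.obc P) = σ.otgc P from rfl] at htgc
  have hN4 : 4 * ((P.N' / 4 : ℕ) : ℤ) ≤ P.N' ∧ (P.N' : ℤ) ≤ 4 * (P.N' / 4 : ℕ) + 3 := by omega
  have hN16 : 16 * ((P.N' / 16 : ℕ) : ℤ) ≤ P.N' ∧ (P.N' : ℤ) ≤ 16 * (P.N' / 16 : ℕ) + 15 := by omega
  have hN2 : 2 * ((P.N' / 2 : ℕ) : ℤ) ≤ P.N' ∧ (P.N' : ℤ) ≤ 2 * (P.N' / 2 : ℕ) + 1 := by omega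
  have hN64 : 64 * ((P.N' / 64 : ℕ) : ℤ) ≤ P.N' ∧ (P.N' : ℤ) ≤ 64 * (P.N' / 64 : ℕ) + 63 := by omega
  have hd : P.d = P.N' / 64 / P.s + 3 := rfl
  have hds1 : ((P.N' / 64 / P.s : ℕ) : ℤ) * P.s ≤ (P.N' / 64 : ℕ) := by exact_mod_cast Nat.div_mul_le_self _ _
  have hds2 : ((P.N' / 64 : ℕ) : ℤ) < ((P.N' / 64 / P.s : ℕ) : ℤ) * P.s + P.s := by exact_mod_cast Nat.lt_div_mul_add (by omega : 0 < P.s)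
  -- the window's lateral indices
  have hylo' := latIdx_spec (r := P.rW) (s := P.s) (by omega) (show -(P.rW : ℤ) ≤ σ.otgo P by omega)
  have hyhi := latIdx_spec (r := P.rW) (s := P.s) (by omega) (show -(P.rW : ℤ) ≤ σ.otgo P + (P.N' / 64 : ℕ) by omega)
  have hyLo1 : 1 ≤ σ.oyLo P := by
    unfold Slot.oyLo
    have : 2 ≤ latIdx P.s P.rW (σ.otgo P) := by
      unfold latIdx
      apply (Nat.le_div_iff_mul_le (by omega)).2
      have : 2 * (P.s : ℤ) ≤ σ.otgo P + P.rW := by omega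
      omega
    omega
  have hyHi : σ.oyHi P + 1 < P.nW := by
    unfold Slot.oyHi
    have : latIdx P.s P.rW (σ.otgo P + (P.N' / 64 : ℕ)) + 3 ≤ P.nW := by
      refine idx_le_of_mul_le (s := P.s) (c := 0) (by omega) ?_ (by omega)
      rw [Nat.cast_add, Nat.cast_ofNat, add_mul, hnW]
      have h1 := hyhi.1
      linarith
    omega
  have hylo : σ.oyLo P ≤ σ.oyHi P := by
    unfold Slot.oyLo Slot.oyHi
    have := latIdx_mono (s := P.s) (r := P.rW) (show σ.otgo P ≤ σ.otgo P + (P.N' / 64 : ℕ) by omega)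
    omega
  -- the exit run of the closed arm
  have hspec := latIdx_spec (r := P.rW) (s := P.s) (by omega) (show -(P.rW : ℤ) ≤ σ.otgc P by omega)
  have hxc : σ.oxc P = latIdx P.s P.rW (σ.otgc P) := rfl
  have hxd : σ.oxc P + P.d < P.nW := by
    have : σ.oxc P + P.d + 1 ≤ P.nW := by
      refine idx_le_of_mul_le (s := P.s) (c := 0) (by omega) ?_ (by omega)
      rw [Nat.cast_add, Nat.cast_add, Nat.cast_one, hd, Nat.cast_add, Nat.cast_ofNat, hxc, add_mul, add_mul, add_mul, hnW]
      have h1 := hspec.1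
      linarith [hds1]
    omega
  have h2 : 2 ≤ latIdx P.s P.rW (σ.otgo P) := by have := hyLo1; unfold Slot.oyLo at this; omega
  have hcast : (((latIdx P.s P.rW (σ.otgo P) - 1 : ℕ) : ℤ) + 1) = latIdx P.s P.rW (σ.otgo P) := by omega
  refine ⟨hnW1, ?_, ?_, ?_, ?_, hyLo1, hyHi, ?_, ?_, ?_, ?_, hxd, ?_, ?_⟩
  · unfold Slot.oloW Slot.ohiW; omega
  · simp only [Slot.ohiW, blockOff]; omega
  · unfold Slot.oloW; exact Nat.le_add_right _ _
  · simp only [Slot.ohiW, blockOff]; omega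
  · unfold Slot.oyLo
    rw [hcast]; exact hylo'.1
  · unfold Slot.oyHi
    rw [Nat.cast_add, Nat.cast_one]
    exact hyhi.2
  · unfold Slot.oyLo
    rw [hcast]; exact hylo'.2
  · unfold Slot.oyHi
    rw [Nat.cast_add, Nat.cast_one, add_mul, one_mul]
    linarith [hyhi.1]
  · rw [hxc]; have := hspec.1; have : (0 : ℤ) ≤ P.e := by positivity
    linarith
  · rw [hxc, hd]
    simp only [Nat.cast_add, Nat.cast_ofNat, add_mul]
    have h2 := hspec.2
    have hes : (P.e : ℤ) ≤ P.s := by omega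
    linarith [hds1, hds2]

/-- **The exit run of the open arm spans the target rows** and stays on the side `0` of ring `B`. [folklore] -/
theorem orunB_facts (hV : P.Valid) :
    σ.oxo P + P.d < P.nB ∧ -(P.rB : ℤ) + (σ.oxo P : ℕ) * P.s - P.e ≤ σ.otgo P ∧
      σ.otgo P + (P.N' / 64 : ℕ) ≤ -(P.rB : ℤ) + ((σ.oxo P : ℕ) + P.d) * P.s - P.e ∧
      -(P.rB : ℤ) + (σ.oxo P : ℕ) * P.s ≤ σ.otgo P ∧ σ.otgo P < -(P.rB : ℤ) + ((σ.oxo P : ℕ) + 1) * P.s := by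
  obtain ⟨hs, hk₀, hμ, hw1, hw2, he1, he2, hε1, hε2, hrB1, hrB2, hrW1, hrW2, hnB, hnW, hN, hWB, hWW, hn, hμM, hR₀, hR₀M, hLB, hLW⟩ := hV.ifacts
  have htgo := otgtRow_mem P.N' (σ.obo P)
  rw [show otgtRow P.N' (σ.obo P) = σ.otgo P from rfl] at htgo
  have hN4 : 4 * ((P.N' / 4 : ℕ) : ℤ) ≤ P.N' ∧ (P.N' : ℤ) ≤ 4 * (P.N' / 4 : ℕ) + 3 := by omega
  have hN16 : 16 * ((P.N' / 16 : ℕ) : ℤ) ≤ P.N' ∧ (P.N' : ℤ) ≤ 16 * (P.N' / 16 : ℕ) + 15 := by omega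
  have hN2 : 2 * ((P.N' / 2 : ℕ) : ℤ) ≤ P.N' ∧ (P.N' : ℤ) ≤ 2 * (P.N' / 2 : ℕ) + 1 := by omega
  have hN64 : 64 * ((P.N' / 64 : ℕ) : ℤ) ≤ P.N' ∧ (P.N' : ℤ) ≤ 64 * (P.N' / 64 : ℕ) + 63 := by omega
  have hd : P.d = P.N' / 64 / P.s + 3 := rfl
  have hds1 : ((P.N' / 64 / P.s : ℕ) : ℤ) * P.s ≤ (P.N' / 64 : ℕ) := by exact_mod_cast Nat.div_mul_le_self _ _
  have hds2 : ((P.N' / 64 : ℕ) : ℤ) < ((P.N' / 64 / P.s : ℕ) : ℤ) * P.s + P.s := by exact_mod_cast Nat.lt_div_mul_add (by omega : 0 < P.s)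
  have hspec := latIdx_spec (r := P.rB) (s := P.s) (by omega) (show -(P.rB : ℤ) ≤ σ.otgo P by omega)
  have hxo : σ.oxo P = latIdx P.s P.rB (σ.otgo P) := rfl
  have hxd : σ.oxo P + P.d < P.nB := by
    have : σ.oxo P + P.d + 1 ≤ P.nB := by
      refine idx_le_of_mul_le (s := P.s) (c := 0) (by omega) ?_ (by omega)
      rw [Nat.cast_add, Nat.cast_add, Nat.cast_one, hd, Nat.cast_add, Nat.cast_ofNat, hxo, add_mul, add_mul, add_mul, hnB]
      have h1 := hspec.1
      linarith [hds1]
    omega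
  refine ⟨hxd, ?_, ?_, hspec.1, hspec.2⟩
  · rw [hxo]; have := hspec.1; have : (0 : ℤ) ≤ P.e := by positivity
    linarith
  · rw [hxo, hd]
    simp only [Nat.cast_add, Nat.cast_ofNat, add_mul]
    have h2 := hspec.2
    have hes : (P.e : ℤ) ≤ P.s := by omega
    linarith [hds1, hds2]

/-! ### Routing: entry pieces and exit runs lie on the arcs -/

/-- A ring tube at a position outside the window lies on the arc (`n = r/s ≥ 1`, window inside the ring). [folklore] -/
theorem _root_.Literature.Probability.Percolation.ringTube_mem_arc_of_out {r e s n lo hi g : ℕ} (hn : n = r / s) (hr : 1 ≤ n) (hlo : lo ≤ hi)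
    (hhi : hi < 12 * n - 4) (hg : g < 12 * n - 4) (hout : g < lo ∨ hi < g) :
    ringTube r e s g ∈ arc (thinRing r e s) (hi + 1) (12 * n - 4 - (hi - lo + 1)) := by
  subst hn
  have hlen := length_thinRing (e := e) hr
  obtain ⟨hg', hget⟩ := List.getElem?_eq_some_iff.1 (getElem?_thinRing (e := e) hr hg)
  have h := getElem_mem_arc_compl (L := thinRing r e s) hlo (by rw [hlen]; exact hhi) hg' hout
  rw [hget, hlen] at h
  exact h

/-- A piece whose position is outside the window lies on the arc (`n = r/s ≥ 1`, `i < 6`, `ι < n`). [folklore] -/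
theorem _root_.Literature.Probability.Percolation.pieceTube_mem_arc_of_out {r e s n lo hi i ι : ℕ} (hn : n = r / s) (hr : 1 ≤ n) (hi6 : i < 6)
    (hι : ι < n) (hlo : lo ≤ hi) (hhi : hi < 12 * n - 4) (hout : piecePos n i ι < lo ∨ hi < piecePos n i ι) :
    pieceTube r e s n i ι ∈ arc (thinRing r e s) (hi + 1) (12 * n - 4 - (hi - lo + 1)) := by
  have hpos := piecePos_mem_block' hr hi6 hι
  have hend : blockEnd n i ≤ 12 * n - 4 := by
    interval_cases i <;> simp only [blockEnd] <;> omega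
  subst hn
  rw [← ringTube_piecePos hr hi6 hι]
  exact ringTube_mem_arc_of_out rfl hr hlo hhi (by omega) hout

/-- **Index gap from lateral gap**: if the position `ξ` has lateral index `≥ ι` (`-r + ι s ≤ ξ`), the
position `ξ'` has lateral index `≤ ι'` (`ξ' < -r + (ι'+1) s`) and `ξ + c s < ξ'`, then `ι + c ≤ ι'`. [folklore] -/
theorem _root_.Literature.Probability.Percolation.lat_gap {s ι ι' c : ℕ} {r ξ ξ' : ℤ} (hs : 0 < s) (h1 : -r + (ι : ℤ) * s ≤ ξ)
    (h2 : ξ' < -r + ((ι' : ℤ) + 1) * s) (hgap : ξ + (c : ℤ) * s < ξ') : ι + c ≤ ι' := by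
  by_contra h'
  push Not at h'
  have : (ι' : ℤ) + 1 ≤ ι + c := by exact_mod_cast h'
  have hs' : (0 : ℤ) < s := by exact_mod_cast hs
  nlinarith

/-- The run length bound: `(d + 5) s ≤ N'/64 + 8 s` for `d = N'/64/s + 3`. [folklore] -/
theorem _root_.Literature.Probability.Percolation.d5_mul_le (N s : ℕ) : (((N / 64 / s + 3 + 5 : ℕ) : ℕ) : ℤ) * s ≤ (N / 64 : ℕ) + 8 * s := by
  have h := Nat.div_mul_le_self (N / 64) s
  have h' : ((N / 64 / s * s : ℕ) : ℤ) ≤ (N / 64 : ℕ) := by exact_mod_cast h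
  push_cast at h' ⊢
  nlinarith

/-- **The beacon of a tip on the side of a target row is far from it**: if the closed tip sits on the
side `0`, its lateral position `ξc` avoids `[tgo - μ - 8s, tgo + N'/64 + μ + 8s]` — by the choice of
the target row bit `obo` (danger zones). [folklore] -/
theorem oξc_far (hV : P.Valid) (hic0 : σ.ic = 0) :
    σ.oξc P + P.μ + 8 * P.s < σ.otgo P ∨ σ.otgo P + (P.N' / 64 : ℕ) + P.μ + 8 * P.s < σ.oξc P := by
  obtain ⟨hs, hk₀, hμ, -, -, -, -, -, -, -, -, -, -, -, -, hN, -, -, -, hμM, -⟩ := hV.ifacts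
  have hff := otgtRow_false_add P.N'
  have hN8 : 8 * ((P.N' / 8 : ℕ) : ℤ) ≤ P.N' ∧ (P.N' : ℤ) ≤ 8 * (P.N' / 8 : ℕ) + 7 := by omega
  have hN64 : 64 * ((P.N' / 64 : ℕ) : ℤ) ≤ P.N' ∧ (P.N' : ℤ) ≤ 64 * (P.N' / 64 : ℕ) + 63 := by omega
  by_cases hD : ODanger P (σ.oξc P)
  · have hbo : σ.obo P = false := by
      unfold Slot.obo; rw [decide_eq_true (show σ.ic = 0 ∧ ODanger P (σ.oξc P) from ⟨hic0, hD⟩)]; rfl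
    have htgo : σ.otgo P = otgtRow P.N' false := by unfold Slot.otgo; rw [hbo]
    obtain ⟨hD1, -⟩ := hD
    right; rw [htgo]; linarith
  · have hbo : σ.obo P = true := by
      unfold Slot.obo; rw [decide_eq_false (show ¬ (σ.ic = 0 ∧ ODanger P (σ.oξc P)) from fun h => hD h.2)]; rfl
    have htgo : σ.otgo P = otgtRow P.N' true := by unfold Slot.otgo; rw [hbo]
    unfold ODanger at hD
    rw [htgo]
    by_contra hno
    push Not at hno
    exact hD ⟨by linarith [hno.1], by linarith [hno.2]⟩

/-- The same for the open tip on the side `3` (the side of the target of the closed arm in the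
colour-exchanged picture). [folklore] -/
theorem oξo_far (hV : P.Valid) (hio3 : σ.io = 3) :
    σ.oξo P + P.μ + 8 * P.s < σ.otgc P ∨ σ.otgc P + (P.N' / 64 : ℕ) + P.μ + 8 * P.s < σ.oξo P := by
  obtain ⟨hs, hk₀, hμ, -, -, -, -, -, -, -, -, -, -, -, -, hN, -, -, -, hμM, -⟩ := hV.ifacts
  have hff := otgtRow_false_add P.N'
  have hN8 : 8 * ((P.N' / 8 : ℕ) : ℤ) ≤ P.N' ∧ (P.N' : ℤ) ≤ 8 * (P.N' / 8 : ℕ) + 7 := by omega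
  have hN64 : 64 * ((P.N' / 64 : ℕ) : ℤ) ≤ P.N' ∧ (P.N' : ℤ) ≤ 64 * (P.N' / 64 : ℕ) + 63 := by omega
  by_cases hD : ODanger P (σ.oξo P)
  · have hbc : σ.obc P = false := by
      unfold Slot.obc; rw [decide_eq_true (show σ.io = 3 ∧ ODanger P (σ.oξo P) from ⟨hio3, hD⟩)]; rfl
    have htgc : σ.otgc P = otgtRow P.N' false := by unfold Slot.otgc; rw [hbc]
    obtain ⟨hD1, -⟩ := hD
    right; rw [htgc]; linarith
  · have hbc : σ.obc P = true := by
      unfold Slot.obc; rw [decide_eq_false (show ¬ (σ.io = 3 ∧ ODanger P (σ.oξo P)) from fun h => hD h.2)]; rfl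
    have htgc : σ.otgc P = otgtRow P.N' true := by unfold Slot.otgc; rw [hbc]
    unfold ODanger at hD
    rw [htgc]
    by_contra hno
    push Not at hno
    exact hD ⟨by linarith [hno.1], by linarith [hno.2]⟩

/-- Lateral positions of admissible tips are negative and at least `-2M` (hence `≥ -r` for the rings). [folklore] -/
theorem oξ_bounds (hV : P.Valid) (hσ : σ.OInRange P) (hadm : σ.OAdmissible P) :
    σ.oξo P < 0 ∧ σ.oξc P < 0 ∧ -(2 * (P.M : ℤ)) ≤ σ.oξo P ∧ -(2 * (P.M : ℤ)) ≤ σ.oξc P := by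
  obtain ⟨hs, hk₀, hμ, hw1, hw2, -, -, -, -, -, -, -, -, -, -, -, -, -, -, -, hR₀, -⟩ := hV.ifacts
  have hko2 : 32 * (σ.oko P : ℤ) ≤ P.μ := by exact_mod_cast P.scale_le hσ.hjo
  have hkc2 : 32 * (σ.okc P : ℤ) ≤ P.μ := by exact_mod_cast P.scale_le hσ.hjc
  obtain ⟨ha1, ha2, ha3, ha4⟩ := hadm
  have hξo : σ.oξo P = σ.oTo P + 2 * σ.oko P + P.w := rfl
  have hξc : σ.oξc P = σ.oTc P + 2 * σ.okc P + P.w := rfl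
  refine ⟨by omega, by omega, by omega, by omega⟩

/-- **The entry piece of the open arm lies on its arc** (it avoids the window of ring `B`): on
different sides by the order of the blocks, on a common side by the row gap (`OSepOK`), which puts
the two lateral indices at least `7` apart. [folklore] -/
theorem ogEo_mem_arc (hV : P.Valid) (hσ : σ.OInRange P) (hadm : σ.OAdmissible P) (hsep : σ.OSepOK P) :
    pieceTube P.rB P.e P.s P.nB σ.io (latIdx P.s P.rB (σ.oξo P)) ∈ arc (thinRing P.rB P.e P.s) (σ.oaB P) P.lenB := by
  obtain ⟨hs, hk₀, hμ, hw1, hw2, he1, he2, hε1, hε2, hrB1, hrB2, -, -, hnB, -, -, -, -, -, -, hR₀, -⟩ := hV.ifacts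
  obtain ⟨hι1, hι2, hnB1, hblo, hhi5, hhiE, hhiR, hsc1, hsc2⟩ := owindowB_facts hV hσ hadm
  have hko1 : (P.k₀ : ℤ) ≤ σ.oko P := by exact_mod_cast le_trapScale P.k₀ σ.jo
  have hkc1 : (P.k₀ : ℤ) ≤ σ.okc P := by exact_mod_cast le_trapScale P.k₀ σ.jc
  obtain ⟨hξo0, -, hξo1, -⟩ := oξ_bounds hV hσ hadm
  have hιo : latIdx P.s P.rB (σ.oξo P) < P.nB := latIdx_lt hnB1 (by exact_mod_cast hnB) hξo0
  have hso := latIdx_spec (r := P.rB) (s := P.s) (by omega) (show -(P.rB : ℤ) ≤ σ.oξo P by omega)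
  have hpos := piecePos_mem_block' hnB1 hσ.hio hιo
  have hlen : P.lenB = 12 * P.nB - 4 - (σ.ohiB P - σ.oloB P + 1) := by unfold OParams.lenB; omega
  rw [show σ.oaB P = σ.ohiB P + 1 from rfl, hlen]
  refine pieceTube_mem_arc_of_out rfl hnB1 hσ.hio hιo (by omega) hhiR ?_
  by_cases hii : σ.io = σ.ic
  · -- common side: indices far apart
    have hgap : σ.oξo P + 7 * P.s < σ.oξc P ∨ σ.oξc P + 7 * P.s < σ.oξo P := by
      have hξo : σ.oξo P = σ.oTo P + 2 * σ.oko P + P.w := rfl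
      have hξc : σ.oξc P = σ.oTc P + 2 * σ.okc P + P.w := rfl
      rcases hsep with h | h | h
      · exact absurd hii h
      · left; omega
      · right; omega
    have hs0 : 0 < P.s := by omega
    rcases hgap with hgap | hgap
    · -- `ιo + 7 ≤ ιc`
      have hidx : latIdx P.s P.rB (σ.oξo P) + 7 ≤ σ.oιc P := lat_gap hs0 hso.1 hsc2 (by push_cast; linarith)
      rw [hii]
      rw [hii] at hpos
      unfold Slot.ohiB Slot.oloB piecePos
      split_ifs with h3 <;> omega
    · -- `ιc + 7 ≤ ιo`
      have hidx : σ.oιc P + 7 ≤ latIdx P.s P.rB (σ.oξo P) := lat_gap hs0 hsc1 hso.2 (by push_cast; linarith)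
      rw [hii]
      rw [hii] at hpos
      unfold Slot.ohiB Slot.oloB piecePos
      split_ifs with h3 <;> omega
  · -- different sides: blocks are ordered
    rcases Nat.lt_or_gt_of_ne hii with hlt | hlt
    · left
      have := blockEnd_le_blockOff (n := P.nB) hlt hσ.hic
      omega
    · right
      have := blockEnd_le_blockOff (n := P.nB) hlt hσ.hio
      omega

/-- **The exit run of the open arm lies on its arc**: its tubes sit at the positions `2xo, …, 2xo + 2d`
of the block of the side `0`; the window of ring `B` is in the block of the side `ic ≠ 0`, or, if
`ic = 0`, far from the run by the danger zones (`oξc_far`). [folklore] -/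
theorem orunB_mem_arc (hV : P.Valid) (hσ : σ.OInRange P) (hadm : σ.OAdmissible P) :
    ∀ T ∈ vchunks P.rB (-(P.rB : ℤ)) P.e P.s (σ.oxo P) (P.d + 1), T ∈ arc (thinRing P.rB P.e P.s) (σ.oaB P) P.lenB := by
  obtain ⟨hs, hk₀, hμ, hw1, hw2, he1, he2, hε1, hε2, hrB1, hrB2, -, -, hnB, -, -, -, -, -, -, hR₀, -⟩ := hV.ifacts
  obtain ⟨hι1, hι2, hnB1, hblo, hhi5, hhiE, hhiR, hsc1, hsc2⟩ := owindowB_facts hV hσ hadm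
  obtain ⟨hxd, -, -, hxo1, hxo2⟩ := orunB_facts (σ := σ) hV
  have hd : P.d = P.N' / 64 / P.s + 3 := rfl
  have hds1 : ((P.N' / 64 / P.s : ℕ) : ℤ) * P.s ≤ (P.N' / 64 : ℕ) := by exact_mod_cast Nat.div_mul_le_self _ _
  intro T hT
  obtain ⟨g, hg1, hg2, rfl⟩ := exists_pos_of_mem_vchunks (show σ.oxo P + P.d < P.rB / P.s from hxd) hT
  have hlen : P.lenB = 12 * P.nB - 4 - (σ.ohiB P - σ.oloB P + 1) := by unfold OParams.lenB; omega
  rw [show σ.oaB P = σ.ohiB P + 1 from rfl, hlen]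
  refine ringTube_mem_arc_of_out rfl hnB1 (by omega) hhiR (by omega) ?_
  by_cases hic0 : σ.ic = 0
  · have hfar := oξc_far hV hic0
    have hs0 : 0 < P.s := by omega
    have hμ0 : (0 : ℤ) ≤ P.μ := by positivity
    rcases hfar with hfar | hfar
    · -- the window is below the run: `ιc + 8 ≤ xo`
      right
      have hidx : σ.oιc P + 8 ≤ σ.oxo P := lat_gap hs0 hsc1 hxo2 (by push_cast; linarith)
      unfold Slot.ohiB Slot.oloB; rw [hic0]; simp only [blockOff, Nat.zero_mod, show (0:ℕ) ≠ 2 from by decide, if_false]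
      omega
    · -- the window is above the run: `xo + (d + 5) ≤ ιc`
      left
      have hd5 := d5_mul_le P.N' P.s
      rw [← hd] at hd5
      have hidx : σ.oxo P + (P.d + 5) ≤ σ.oιc P := lat_gap hs0 hxo1 hsc2 (by linarith)
      unfold Slot.oloB; rw [hic0]; simp only [blockOff, Nat.zero_mod, show (0:ℕ) ≠ 2 from by decide, if_false]
      omega
  · left
    have := blockEnd_le_blockOff (n := P.nB) (Nat.pos_of_ne_zero hic0) hσ.hic
    simp only [blockEnd] at this
    omega

/-- **The entry piece of the closed arm lies on its arc** (it avoids the window of ring `W`, which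
sits in the block of the side `3` of the colour-exchanged picture): on another side by the order of
the blocks, on the side `3` (`ic = 0`) by the danger zones (`oξc_far`). [folklore] -/
theorem ogEc_mem_arc (hV : P.Valid) (hσ : σ.OInRange P) (hadm : σ.OAdmissible P) :
    pieceTube P.rW P.e P.s P.nW σ.ic' (latIdx P.s P.rW (σ.oξc P)) ∈ arc (thinRing P.rW P.e P.s) (σ.oaW P) (σ.olenW P) := by
  obtain ⟨hs, hk₀, hμ, hw1, hw2, he1, he2, hε1, hε2, -, -, hrW1, hrW2, -, hnW, -, -, -, -, -, hR₀, -⟩ := hV.ifacts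
  obtain ⟨hnW1, hlohi, hhiR, hblo, hhiB4, hyLo1, hyHi, hylo, hyhi, hylo2, hyhi2, -⟩ := owindowW_facts (σ := σ) hV
  have hic' : σ.ic' < 6 := Nat.mod_lt _ (by norm_num)
  obtain ⟨-, hξc0, -, hξc1⟩ := oξ_bounds hV hσ hadm
  have hιc : latIdx P.s P.rW (σ.oξc P) < P.nW := latIdx_lt hnW1 (by exact_mod_cast hnW) hξc0
  have hsc := latIdx_spec (r := P.rW) (s := P.s) (by omega) (show -(P.rW : ℤ) ≤ σ.oξc P by omega)
  have hpos := piecePos_mem_block' hnW1 hic' hιc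
  rw [show σ.oaW P = σ.ohiW P + 1 from rfl, show σ.olenW P = 12 * P.nW - 4 - (σ.ohiW P - σ.oloW P + 1) from rfl]
  refine pieceTube_mem_arc_of_out rfl hnW1 hic' hιc hlohi hhiR ?_
  by_cases h3 : σ.ic' = 3
  · -- `ic = 0`: the closed beacon is far from the rows of the open approach tube
    have hic0 : σ.ic = 0 := by
      have : σ.ic' = (σ.ic + 3) % 6 := rfl
      have := hσ.hic; omega
    have hfar := oξc_far hV hic0
    have hs0 : 0 < P.s := by omega
    have hμ0 : (0 : ℤ) ≤ P.μ := by positivity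
    rw [h3] at hpos ⊢
    rcases hfar with hfar | hfar
    · left
      -- `latIdx ξc + 8 ≤ oyLo + 1`
      have hidx : latIdx P.s P.rW (σ.oξc P) + 8 ≤ σ.oyLo P + 1 :=
        lat_gap hs0 hsc.1 (by push_cast; exact hylo2) (by push_cast; linarith)
      unfold Slot.oloW piecePos; simp only [show (3:ℕ) % 3 = 0 from rfl, show (0:ℕ) ≠ 2 from by decide, if_false]
      omega
    · right
      have hidx : σ.oyHi P + 7 ≤ latIdx P.s P.rW (σ.oξc P) :=
        lat_gap (ξ := σ.otgo P + (P.N' / 64 : ℕ) + P.s) hs0 hyhi2 hsc.2 (by simp only [Nat.cast_ofNat]; linarith)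
      unfold Slot.ohiW piecePos; simp only [show (3:ℕ) % 3 = 0 from rfl, show (0:ℕ) ≠ 2 from by decide, if_false]
      omega
  · simp only [blockOff] at hhiB4 hblo
    rcases Nat.lt_or_gt_of_ne h3 with hlt | hlt
    · left
      have := blockEnd_le_blockOff (n := P.nW) hlt (by norm_num : 3 < 6)
      simp only [blockOff] at this
      omega
    · right
      have := blockEnd_le_blockOff (n := P.nW) hlt hic'
      simp only [blockEnd] at this
      omega

/-- **The exit run of the closed arm lies on its arc**: it sits in the block of the side `0` of the
colour-exchanged picture, before the window of ring `W` (block of the side `3`). [folklore] -/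
theorem orunW_mem_arc (hV : P.Valid) :
    ∀ T ∈ vchunks P.rW (-(P.rW : ℤ)) P.e P.s (σ.oxc P) (P.d + 1), T ∈ arc (thinRing P.rW P.e P.s) (σ.oaW P) (σ.olenW P) := by
  obtain ⟨hnW1, hlohi, hhiR, hblo, -, -, -, -, -, -, -, hxd, -⟩ := owindowW_facts (σ := σ) hV
  intro T hT
  obtain ⟨g, hg1, hg2, rfl⟩ := exists_pos_of_mem_vchunks (show σ.oxc P + P.d < P.rW / P.s from hxd) hT
  rw [show σ.oaW P = σ.ohiW P + 1 from rfl, show σ.olenW P = 12 * P.nW - 4 - (σ.ohiW P - σ.oloW P + 1) from rfl]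
  refine ringTube_mem_arc_of_out rfl hnW1 hlohi hhiR (by omega) (Or.inl ?_)
  simp only [blockOff] at hblo
  omega

end Slot

end Literature.Probability.Percolation
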